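import Mathlib
import Summits.ValiantsHypothesis.ValiantsHypothesis.Theorems.GrenetZeonPolySizeQPAlgebraCorankTwoForms
import HarnessLib

/-!
# Crux `GrenetZeon.PolySizeQPAlgebra` (stmt-ValiantsHypothesis-8064), line `vbp-slice-dealg` —
# the symmetrised `q × q` form `G` of `…BlockRankGeneral` factors through an explicit image

`rank_hess0_transl_le_of_blockNormalForm_general` (`…BlockRankGeneral`) bounds the Hessian rank at a
block normal form `diag(1_κ, S)` by `rank G + |κ|·(ℓ Col adj S + ℓ Row adj S)`, where `G` is the
`σ × σ` matrix `(s,t) ↦ λ(τ_s β(Z_t) + τ_t β(Z_s) + H(Z_s, Z_t))`, `β(Z) = tr(adj S · Z)`,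
`H(Z, Z') = Σ_{r ≠ r'} det(S | row r ← Z'_r, row r' ← Z_{r'})` (the second polarisation of `det` at `S`).
The input `G(q)` of the census asks for `rank G ≤ 2q · dim R`.  This file turns `rank G` into the
currency of `AL(q)` — the `ℂ`-dimension of an explicit module — for every `q` and every coefficient
algebra:

* `sum_det_updateRow_updateRow_comm` — `H` is symmetric (`Matrix.updateRow_comm`);
* `secondPolar_eq_sum_single` — `H(Y, Y') = Σ_{kl} Y'_{kl} · H(Y, E_{kl})`, i.e. `H(Y, ·)` is
  represented by the matrix `(H(Y, E_{kl}))_{kl}` (`E_{kl} = Matrix.single k l 1`);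
* `rank_symmetrised_form_le_finrank` — **`rank G ≤ dim_ℂ V` for every `ℂ`-subspace
  `V ⊆ R × Mat_q(R)` containing the representing vectors
  `Ψ_s = (β(Z_s), (τ_s β(E_{kl}) + H(Z_s, E_{kl}))_{kl})` of all `s`.**

So `G(q)` for a local type follows from a dimension count of the module spanned by the `Ψ_s`
(for the type `(1,2,1,1)`: degree-one part spanned by `9` vectors, the rest inside `(x²R)^{10}`,
total `≤ 29 < 30`; to be landed separately).  HONEST FRAMING: linear-algebra plumbing; no stub of the
line is closed; VP ≠ VNP is not moved.

References: T. Mignon, N. Ressayre, IMRN 2004:79, §2 [MignonRessayre2004].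
-/

noncomputable section

open Matrix

-- single-conjunct layout `Summits/ValiantsHypothesis/ValiantsHypothesis`: duplicated namespace by design
set_option linter.dupNamespace false

namespace Summit.ValiantsHypothesis.ValiantsHypothesis.Theorems.GrenetZeonPolySizeQPAlgebra

section SymForm

variable {R : Type*} [CommRing R] {q : ℕ}

/-- **Symmetry of the second polarisation.**
`Σ_{r≠r'} det(S | r ← Y'_r, r' ← Y_{r'}) = Σ_{r≠r'} det(S | r ← Y_r, r' ← Y'_{r'})`. [folklore] -/
theorem sum_det_updateRow_updateRow_comm (S Y Y' : Matrix (Fin q) (Fin q) R) :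
    (∑ r, ∑ r', if r' = r then 0 else ((S.updateRow r (Y' r)).updateRow r' (Y r')).det) =
      ∑ r, ∑ r', if r' = r then 0 else ((S.updateRow r (Y r)).updateRow r' (Y' r')).det := by
  rw [Finset.sum_comm]
  refine Finset.sum_congr rfl fun a _ => Finset.sum_congr rfl fun b _ => ?_
  by_cases h : a = b
  · subst h; simp
  · rw [if_neg h, if_neg (Ne.symm h), Matrix.updateRow_comm _ (Ne.symm h)]

/-- The outer row-replacement sum `Y ↦ Σ_{r≠r'} det(N_r | r' ← Y_{r'})` is additive. [folklore] -/
theorem sum_det_updateRow_add (N : Fin q → Matrix (Fin q) (Fin q) R) (Y₁ Y₂ : Matrix (Fin q) (Fin q) R) :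
    (∑ r, ∑ r', if r' = r then 0 else ((N r).updateRow r' ((Y₁ + Y₂) r')).det) =
      (∑ r, ∑ r', if r' = r then 0 else ((N r).updateRow r' (Y₁ r')).det) +
        ∑ r, ∑ r', if r' = r then 0 else ((N r).updateRow r' (Y₂ r')).det := by
  rw [← Finset.sum_add_distrib]
  refine Finset.sum_congr rfl fun r _ => ?_
  rw [← Finset.sum_add_distrib]
  refine Finset.sum_congr rfl fun r' _ => ?_
  split_ifs
  · simp
  · exact Matrix.det_updateRow_add _ _ _ _

/-- The outer row-replacement sum is homogeneous. [folklore] -/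
theorem sum_det_updateRow_smul (N : Fin q → Matrix (Fin q) (Fin q) R) (c : R)
    (Y : Matrix (Fin q) (Fin q) R) :
    (∑ r, ∑ r', if r' = r then 0 else ((N r).updateRow r' ((c • Y) r')).det) =
      c * ∑ r, ∑ r', if r' = r then 0 else ((N r).updateRow r' (Y r')).det := by
  rw [Finset.mul_sum]
  refine Finset.sum_congr rfl fun r _ => ?_
  rw [Finset.mul_sum]
  refine Finset.sum_congr rfl fun r' _ => ?_
  split_ifs
  · simp
  · exact Matrix.det_updateRow_smul _ _ _ _

/-- An `R`-linear functional on `q × q` matrices is determined by its values on the elementary matrices: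
`f Y = Σ_{k,l} Y_{kl} · f(E_{kl})`. [folklore] -/
theorem matrixLinearMap_apply_eq_sum_single (f : Matrix (Fin q) (Fin q) R →ₗ[R] R)
    (Y : Matrix (Fin q) (Fin q) R) :
    f Y = ∑ k, ∑ l, Y k l * f (Matrix.single k l 1) := by
  conv_lhs => rw [Matrix.matrix_eq_sum_single Y]
  rw [map_sum]
  refine Finset.sum_congr rfl fun k _ => ?_
  rw [map_sum]
  refine Finset.sum_congr rfl fun l _ => ?_
  rw [show Matrix.single k l (Y k l) = Y k l • Matrix.single k l (1 : R) by
    rw [Matrix.smul_single, smul_eq_mul, mul_one], map_smul, smul_eq_mul]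

/-- **Representation of the second polarisation**: for fixed inner rows `N_r`,
`Σ_{r≠r'} det(N_r | r' ← Y_{r'}) = Σ_{k,l} Y_{kl} · Σ_{r≠r'} det(N_r | r' ← (E_{kl})_{r'})`. [folklore] -/
theorem sum_det_updateRow_eq_sum_single (N : Fin q → Matrix (Fin q) (Fin q) R)
    (Y : Matrix (Fin q) (Fin q) R) :
    (∑ r, ∑ r', if r' = r then 0 else ((N r).updateRow r' (Y r')).det) =
      ∑ k, ∑ l, Y k l *
        ∑ r, ∑ r', if r' = r then 0 else ((N r).updateRow r' (Matrix.single k l (1 : R) r')).det := by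
  let f : Matrix (Fin q) (Fin q) R →ₗ[R] R :=
    { toFun := fun Y => ∑ r, ∑ r', if r' = r then 0 else ((N r).updateRow r' (Y r')).det
      map_add' := fun Y₁ Y₂ => sum_det_updateRow_add N Y₁ Y₂
      map_smul' := fun c Y => by rw [RingHom.id_apply, smul_eq_mul]; exact sum_det_updateRow_smul N c Y }
  exact matrixLinearMap_apply_eq_sum_single f Y

/-- `tr(adj S · Y) = Σ_{k,l} Y_{kl} · tr(adj S · E_{kl})`. [folklore] -/
theorem trace_adjugate_mul_eq_sum_single (S Y : Matrix (Fin q) (Fin q) R) :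
    (S.adjugate * Y).trace = ∑ k, ∑ l, Y k l * (S.adjugate * Matrix.single k l 1).trace := by
  let f : Matrix (Fin q) (Fin q) R →ₗ[R] R :=
    { toFun := fun Y => (S.adjugate * Y).trace
      map_add' := fun Y₁ Y₂ => by rw [Matrix.mul_add, Matrix.trace_add]
      map_smul' := fun c Y => by rw [Matrix.mul_smul, Matrix.trace_smul, RingHom.id_apply] }
  exact matrixLinearMap_apply_eq_sum_single f Y

/-- **The symmetrised form is a read-out of the representing vectors.**  With
`β(Z) = tr(adj S · Z)`, `H(Z, Z') = Σ_{r≠r'} det(S | r ← Z'_r, r' ← Z_{r'})` and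
`Ψ₂(s)_{kl} = τ_s β(E_{kl}) + Σ_{r≠r'} det(S | r ← (Z_s)_r, r' ← (E_{kl})_{r'})`:
`τ_s β(Z_t) + τ_t β(Z_s) + H(Z_s, Z_t) = τ_t β(Z_s) + Σ_{kl} (Z_t)_{kl} Ψ₂(s)_{kl}`. [folklore] -/
theorem symmetrised_form_eq_readOut (S : Matrix (Fin q) (Fin q) R) (τs τt : R)
    (Zs Zt : Matrix (Fin q) (Fin q) R) :
    τs * (S.adjugate * Zt).trace + τt * (S.adjugate * Zs).trace +
        (∑ r, ∑ r', if r' = r then 0 else ((S.updateRow r (Zt r)).updateRow r' (Zs r')).det) =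
      τt * (S.adjugate * Zs).trace + ∑ k, ∑ l, Zt k l *
        (τs * (S.adjugate * Matrix.single k l 1).trace +
          ∑ r, ∑ r', if r' = r then 0 else
            ((S.updateRow r (Zs r)).updateRow r' (Matrix.single k l (1 : R) r')).det) := by
  rw [sum_det_updateRow_updateRow_comm S Zs Zt,
    sum_det_updateRow_eq_sum_single (fun r => S.updateRow r (Zs r)) Zt,
    trace_adjugate_mul_eq_sum_single S Zt]
  have h : ∀ k, τs * ∑ l, Zt k l * (S.adjugate * Matrix.single k l 1).trace +
      ∑ l, Zt k l * ∑ r, ∑ r', (if r' = r then 0 else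
        ((S.updateRow r (Zs r)).updateRow r' (Matrix.single k l (1 : R) r')).det) =
      ∑ l, Zt k l * (τs * (S.adjugate * Matrix.single k l 1).trace +
        ∑ r, ∑ r', if r' = r then 0 else
          ((S.updateRow r (Zs r)).updateRow r' (Matrix.single k l (1 : R) r')).det) := by
    intro k
    rw [Finset.mul_sum, ← Finset.sum_add_distrib]
    exact Finset.sum_congr rfl fun l _ => by ring
  rw [Finset.mul_sum, add_right_comm, ← Finset.sum_add_distrib, add_comm]
  exact congrArg _ (Finset.sum_congr rfl fun k _ => h k)

variable {σ : Type*} [Fintype σ] [Algebra ℂ R] [Module.Finite ℂ R]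

/-- **`rank G ≤ dim_ℂ V` for every `ℂ`-subspace `V` containing the representing vectors.**
Let `λ : R → ℂ` be linear, `S ∈ Mat_q(R)`, `τ : σ → R`, `Z : σ → Mat_q(R)`, and let
`V ⊆ R × Mat_q(R)` be a `ℂ`-subspace containing, for every `s`,
`Ψ_s = (tr(adj S · Z_s), (τ_s tr(adj S · E_{kl}) + Σ_{r≠r'} det(S | r ← (Z_s)_r, r' ← (E_{kl})_{r'}))_{kl})`.
Then the symmetrised form
`G = ((s,t) ↦ λ(τ_s tr(adj S·Z_t) + τ_t tr(adj S·Z_s) + Σ_{r≠r'} det(S | r ← (Z_t)_r, r' ← (Z_s)_{r'})))`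
of `rank_hess0_transl_le_of_blockNormalForm_general` has `rank G ≤ dim_ℂ V`: its entries are
`φ_t(Ψ_s)` for the linear functionals `φ_t(v) = λ(τ_t v₁ + Σ_{kl} (Z_t)_{kl} (v₂)_{kl})`
(`symmetrised_form_eq_readOut`, `rank_linear_readOut_le`). [cite: MignonRessayre2004, §2] -/
theorem rank_symmetrised_form_le_finrank (l : R →ₗ[ℂ] ℂ) (S : Matrix (Fin q) (Fin q) R)
    (τ : σ → R) (Z : σ → Matrix (Fin q) (Fin q) R)
    (V : Submodule ℂ (R × Matrix (Fin q) (Fin q) R))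
    (hV : ∀ s, ((S.adjugate * Z s).trace,
      Matrix.of fun k l => τ s * (S.adjugate * Matrix.single k l 1).trace +
        ∑ r, ∑ r', if r' = r then 0 else
          ((S.updateRow r (Z s r)).updateRow r' (Matrix.single k l (1 : R) r')).det) ∈ V) :
    (Matrix.of fun s t => l (τ s * (S.adjugate * Z t).trace + τ t * (S.adjugate * Z s).trace +
      ∑ r, ∑ r', if r' = r then 0 else ((S.updateRow r (Z t r)).updateRow r' (Z s r')).det)).rank ≤
      Module.finrank ℂ V := by
  classical
  set w : σ → V := fun s => ⟨_, hV s⟩ with hw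
  let φ : σ → (V →ₗ[ℂ] ℂ) := fun t =>
    { toFun := fun v => l (τ t * (v : R × Matrix (Fin q) (Fin q) R).1 +
        ∑ k, ∑ l', Z t k l' * (v : R × Matrix (Fin q) (Fin q) R).2 k l')
      map_add' := fun v v' => by
        rw [← map_add]
        congr 1
        simp only [Submodule.coe_add, Prod.fst_add, Prod.snd_add, Matrix.add_apply, mul_add,
          Finset.sum_add_distrib]
        ring
      map_smul' := fun c v => by
        rw [RingHom.id_apply, ← map_smul]
        congr 1
        simp only [Submodule.coe_smul, Prod.smul_fst, Prod.smul_snd, Matrix.smul_apply,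
          mul_smul_comm, smul_add, Finset.smul_sum] }
  have hM : (Matrix.of fun s t => l (τ s * (S.adjugate * Z t).trace +
      τ t * (S.adjugate * Z s).trace +
      ∑ r, ∑ r', if r' = r then 0 else ((S.updateRow r (Z t r)).updateRow r' (Z s r')).det)) =
      Matrix.of fun s t => φ t (w s) := by
    ext s t
    simp only [Matrix.of_apply, hw]
    rw [symmetrised_form_eq_readOut]
    rfl
  rw [hM]
  exact rank_linear_readOut_le w φ

end SymForm

end Summit.ValiantsHypothesis.ValiantsHypothesis.Theorems.GrenetZeonPolySizeQPAlgebra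

end
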